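import Summits.MatrixMultiplication.MatrixMultiplication.Theses.CharacteristicContinuity
import Literature.Computability.AlgebraicComplexity.MatrixMultiplicationExponentInf

/-!
# Crux `ContinuityAtZero` (stmt-MatrixMultiplication-18039) — `Lines/birth.lean`, the BC3 birth skeleton

Route `CharacteristicContinuity` (route-MatrixMultiplication-CharacteristicContinuity; deciding theorem
`closes : LargeCharacteristicFast → ContinuityAtZero → MatrixMultiplication`, proved in the route file).
The crux, over the tree's `omega` / `tensorRank` / `matMulTensor`
(`Literature/Computability/AlgebraicComplexity/MatrixMultiplicationExponent.lean`), re-checked below as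
`continuityAtZero_iff` (`Iff.rfl`):

  `ContinuityAtZero : ∀ ε > 0, ∃ p₀, ∀ primes p ≥ p₀, ω(ℂ) ≤ ω(F̄_p) + ε`     (`F̄_p = AlgebraicClosure (ZMod p)`)

— lower semicontinuity of `ω` at characteristic zero along the primes, `ω(ℂ) ≤ liminf_p ω(F̄_p)` (K).

## The line: uniform witness sizes (open) + downward Lefschetz for ONE Brent system (provable) → K by pigeonhole

This is the route header's OWN foreseen split of the crux (TWO-LAYER PLAN: "ContinuityAtZero ⇐
UniformWitness (open) → TransferDown (proved) → ContinuityAtZero (pigeonhole)"), made kernel-checked: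

* `stub_uniformWitness` — **near-optimal characteristic-`p` algorithms occur at sizes bounded uniformly
  in `p` (open; load-bearing)**: for every `ε > 0` there are `N, p₀` such that every prime `p ≥ p₀` has
  a format `2 ≤ n ≤ N` with `R_{F̄_p}(⟨n,n,n⟩) ≤ n^{ω(F̄_p)+ε}`.  Literally the right-hand side of the
  route's support item `UniformWitnessIff` (stmt-MatrixMultiplication-18043: `ContinuityAtZero ↔ this`),
  so — once that support lands — it is EQUIVALENT to the crux: the regularity reading of K.  For each
  single prime such an `n` exists (`exists_logb_tensorRank_matMulTensor_le`, tree); the content is the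
  uniformity of the size in `p`.  Its negation is a concrete object: a CHARACTERISTIC-SPORADIC fast
  family — infinitely many primes whose `ε`-near-optimal schemes all live at sizes `n > N`, for every
  `N` — the asymptotic form of the finite phenomenon `R_{𝔽₂}(⟨4,4,4⟩) ≤ 47 < 48` (FawziEtAl2022;
  KauersMoosbauer2022FlipGraphs §5: no rank-47 `𝔽₂`-scheme found lifts mod 4).  Size XL / open-problem.
* `stub_transferDown` — **downward Lefschetz for one Brent system (provable now)**: for fixed `n, r`,
  if `R_{F̄_p}(⟨n,n,n⟩) ≤ r` for infinitely many primes `p`, then `R_ℂ(⟨n,n,n⟩) ≤ r`.  Why true: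
  "`⟨n,n,n⟩` is a sum of `r` triads" is an existential first-order sentence `φ_{n,r}` in the language of
  rings (`3rn²` variables, `n⁶` cubic equations with 0/1 right-hand sides); `F̄_p ⊨ φ ↔ ACF_p ⊨ φ`
  (completeness of `ACF_p`), and `ACF_0 ⊨ φ ↔ {p | ACF_p ⊨ φ}` is infinite (Mathlib
  `FirstOrder.Field.ACF_zero_realize_iff_infinite_ACF_prime_realize`), then `ℂ ⊨ ACF_0`; the rank
  side is `tensorRank t ≤ r ↔ ∃` a decomposition into exactly `r` triads (pad with zero triads; the
  infimum is attained over finite index types, `exists_triad_decomposition_tensorRank`).  The route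
  planner reports this proved sorry-free in its folder (`tensorRank_transfer_down`, bc/CharTransfer.lean,
  not visible from this seat).  Size M (the first-order encoding of the Brent equations and its
  `realize` lemma are the work), provable now.
* `continuityAtZero_of_uniformWitness_transferDown` — the sorry-free CORE with the two stub statements
  as explicit hypotheses (pigeonhole + exponent bookkeeping): given `ε`, take `N, p₀` from the uniform
  witness; for each of the finitely many pairs `(n, r)`, `n ≤ N`, `r ≤ N³`, EITHER `R_{F̄_p}(⟨n,n,n⟩) ≤ r`
  for infinitely many `p` — then `R_ℂ(⟨n,n,n⟩) ≤ r` outright by the transfer — OR it fails for all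
  primes beyond some `q(n,r)`; put `p₁ = max(p₀, max_{n,r} q(n,r))` (`Finset.sup`).  For a prime
  `p ≥ p₁` the witness `n` with `r := R_{F̄_p}(⟨n,n,n⟩) ≤ n³ ≤ N³` (`tensorRank_matMulTensor_le`) is in
  the first case (it holds AT `p ≥ q(n,r)`), so `R_ℂ(⟨n,n,n⟩) ≤ r ≤ n^{ω(F̄_p)+ε}`, whence
  `ω(ℂ) ≤ log_n r ≤ ω(F̄_p) + ε` (`advxxz2025_omega_le_logb_of_tensorRank_le`, Bläser 2013 Thm 5.9;
  `Real.logb_le_iff_le_rpow`, `tensorRank_matMulTensor_pos`).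
* `ContinuityAtZero_of : ContinuityAtZero` — THE skeleton theorem (the only theorem of the file that
  concludes the crux by name): the crux from the two declared stubs (the only `sorry`s of the file)
  through the core and the `Iff.rfl` bridge.  The arrow shape `stub₁-sig → stub₂-sig → crux` is the
  core followed by `continuityAtZero_iff.mpr` (sorry-free).

Honest status.  Given `stub_transferDown` (provable now) the open stub `stub_uniformWitness` implies the
crux, and by the route's (reportedly proved) support `UniformWitnessIff` it is EQUIVALENT to it: the
skeleton certifies the route's reduction "K ⇐ uniform witness sizes + one-system Lefschetz" and
isolates the provable model-theoretic piece; it does not split the open content of K itself — every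
sufficient condition for K that K implies is of course equivalent to K; the value of this cut is that
the open stub speaks of FINITELY MANY FORMATS per `ε` (bounded `n`, ranks `≤ N³`), which is what
effective-Nullstellensatz / height arguments and finite censuses (support `SporadicRankDrop`,
stmt-MatrixMultiplication-18045) can touch.  Two alternative cuts are recorded in `Lines/birth.md`, not
registered here (one line per file): (a) EFFECTIVE THRESHOLD + SLOW GROWTH — an explicit `P(n)`
(arithmetic Nullstellensatz, Krick–Pardo–Sombra heights: `log P(n) ≲ 3^{O(n⁵)}`) beyond which
`R_{F̄_p}(⟨n,n,n⟩) = R_ℂ(⟨n,n,n⟩)`, plus "ε-near-optimal characteristic-`p` witnesses occur at some size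
`n` with `P(n) < p`" (weaker than uniform sizes, no pigeonhole); (b) LIFTING FORM — `∀ ε ∃ C p₀ ∀ p ≥ p₀
∀ n ≥ 2, R_ℂ(⟨n,n,n⟩) ≤ C n^ε R_{F̄_p}(⟨n,n,n⟩)`, K then by `ω = inf_n log_n R(⟨n,n,n⟩)`
(`advxxz2025_omega_eq_iInf_logb_tensorRank`).  Disproof used: none exists (`ledger crux ls
stmt-MatrixMultiplication-18039`: no workfiles before this one, no `Disproof.lean`, no `Negative/`
lemma; the 11 entries of `ledger negatives --problem MatrixMultiplication` are STPP / design /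
module-rank statements, none about `ω` or ranks over fields of positive characteristic), so no
`_false_without_` obligation applies and no stub instantiates a refuted statement.  Barriers honoured:
InfimumNotMinimumBarrier — both stubs move single finite rank bounds `R(⟨n,n,n⟩) ≤ r` between
characteristics, never an attained exponent, and K stays a limit statement in `p` and `ε`;
Irreversibility / UniversalMethod / Rectangular / NilpotentGroup barriers — not in play (no intermediate
tensor, no group; no upper-bound METHOD is used, only transfer of whatever near-optimal schemes exist).

BC3 probes (planner-run with `lean check`, `maxHeartbeats 400000`, files `bc/probe_*.lean` in the
planner folder, NOT importing this file so the sorried theorems cannot leak): `stubᵢ → ContinuityAtZero`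
and `stubᵢ → _root_.MatrixMultiplication` for `i = 1, 2`, each as
`example : S → T := by first | exact? | simpa | aesop`, in the in-context form
`example (h : S) : T := by first | exact? | simpa using h | aesop`, in the BC2 unfolding form, and
per tactic — all must FAIL; verdicts quoted in `Lines/birth.md`.
-/

-- `Summit.<Summit>.<Problem>`: for the single-conjunct summit the duplicate component is mandated.
set_option linter.dupNamespace false

noncomputable section

namespace Summit.MatrixMultiplication.MatrixMultiplication.Cruxes.ContinuityAtZero.Birth

open Literature.Computability.AlgebraicComplexity
open Summit.MatrixMultiplication.MatrixMultiplication.Theses.CharacteristicContinuity (ContinuityAtZero)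

/-! ## Bridge: the crux text, definitionally -/

/-- `ContinuityAtZero` is, definitionally, "for every `ε > 0`, `ω(ℂ) ≤ ω(F̄_p) + ε` for all primes
`p` beyond some `p₀`" (`F̄_p = AlgebraicClosure (ZMod p)`). [folklore] -/
theorem continuityAtZero_iff :
    ContinuityAtZero ↔
      ∀ ε : ℝ, 0 < ε → ∃ p₀ : ℕ, ∀ (p : ℕ) [Fact p.Prime], p₀ ≤ p →
        omega ℂ ≤ omega (AlgebraicClosure (ZMod p)) + ε :=
  Iff.rfl

/-! ## The two registered stubs (the only `sorry`s of this file) -/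

/-- **Stub 1 — uniform witness sizes (open; load-bearing).**  For every `ε > 0` there are `N, p₀`
such that every prime `p ≥ p₀` has a format `2 ≤ n ≤ N` whose rank over `F̄_p` already certifies
`ω(F̄_p)` up to `ε`: `R_{F̄_p}(⟨n,n,n⟩) ≤ n^{ω(F̄_p)+ε}`.  Literally the right-hand side of the route's
support item `UniformWitnessIff` (stmt-MatrixMultiplication-18043), hence equivalent to the crux once
that support lands; for each single `p` such an `n` exists (`exists_logb_tensorRank_matMulTensor_le`),
the content is uniformity in `p`.  Why it might fail: a characteristic-sporadic fast family (for
infinitely many `p`, all `ε`-near-optimal `F̄_p`-schemes at sizes `→ ∞`), the asymptotic form of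
`R_{𝔽₂}(⟨4,4,4⟩) ≤ 47` vs `48` over `ℚ` (FawziEtAl2022, KauersMoosbauer2022FlipGraphs §5); no lifting
or uniformity tool is known (Blaser2013 §5, BurgisserClausenShokrollahi1997 p. 410, Problem 15.3).
Size XL / open-problem.  Sources: BurgisserClausenShokrollahi1997, Blaser2013, FawziEtAl2022,
KauersMoosbauer2022FlipGraphs, Schonhage1981. -/
theorem stub_uniformWitness :
    ∀ ε : ℝ, 0 < ε → ∃ N p₀ : ℕ, ∀ (p : ℕ) [Fact p.Prime], p₀ ≤ p →
      ∃ n : ℕ, 2 ≤ n ∧ n ≤ N ∧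
        (tensorRank (matMulTensor (AlgebraicClosure (ZMod p)) n n n) : ℝ) ≤
          (n : ℝ) ^ (omega (AlgebraicClosure (ZMod p)) + ε) := by
  sorry

/-- **Stub 2 — downward Lefschetz transfer for ONE Brent system (provable now).**  For fixed `n, r`:
if `R_{F̄_p}(⟨n,n,n⟩) ≤ r` for infinitely many primes `p` (for every `p₀` some prime `p ≥ p₀`), then
`R_ℂ(⟨n,n,n⟩) ≤ r`.  Why true: "`⟨n,n,n⟩` is a sum of `r` triads" is an `∃`-sentence `φ_{n,r}` of
the language of rings; `AlgebraicClosure (ZMod p) ⊨ φ ↔ ACF_p ⊨ φ` (completeness), `ACF_0 ⊨ φ ↔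
{p | ACF_p ⊨ φ}` infinite (`FirstOrder.Field.ACF_zero_realize_iff_infinite_ACF_prime_realize`),
`ℂ ⊨ ACF_0`; and `tensorRank t ≤ r ↔` a decomposition into exactly `r` triads exists (zero-padding;
`exists_triad_decomposition_tensorRank`, `tensorRank_le_of_eq_sum`).  Size M.  Sources:
BurgisserClausenShokrollahi1997 (§15.3, Cor. (15.18) context; p. 410), Blaser2013 (§4–5); Mathlib
`Mathlib/ModelTheory/Algebra/Field/IsAlgClosed.lean`. -/
theorem stub_transferDown :
    ∀ n r : ℕ,
      (∀ p₀ : ℕ, ∃ (p : ℕ) (_ : Fact p.Prime), p₀ ≤ p ∧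
        tensorRank (matMulTensor (AlgebraicClosure (ZMod p)) n n n) ≤ r) →
      tensorRank (matMulTensor ℂ n n n) ≤ r := by
  sorry

/-! ## Sorry-free core -/

/-- **Composition with explicit hypotheses** (the BC3 shape `stub₁-sig → stub₂-sig → crux-content`):
from uniform witness sizes (`hUW`) and the one-system downward transfer (`hTD`), lower semicontinuity
of `ω` at characteristic zero along the primes.  Proof: pigeonhole over the finitely many pairs
`(n, r)`, `n ≤ N`, `r ≤ N³` — each pair either transfers outright (infinitely many primes) or dies
beyond some `q(n,r)`; past `max(p₀, max q)` the witness pair of `p` is alive at `p`, hence of the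
first kind, so `R_ℂ(⟨n,n,n⟩) ≤ R_{F̄_p}(⟨n,n,n⟩) ≤ n^{ω(F̄_p)+ε}` and `ω(ℂ) ≤ log_n R_ℂ ≤ ω(F̄_p) + ε`.
Sorry-free, standard axioms. [folklore] -/
theorem continuityAtZero_of_uniformWitness_transferDown
    (hUW : ∀ ε : ℝ, 0 < ε → ∃ N p₀ : ℕ, ∀ (p : ℕ) [Fact p.Prime], p₀ ≤ p →
      ∃ n : ℕ, 2 ≤ n ∧ n ≤ N ∧
        (tensorRank (matMulTensor (AlgebraicClosure (ZMod p)) n n n) : ℝ) ≤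
          (n : ℝ) ^ (omega (AlgebraicClosure (ZMod p)) + ε))
    (hTD : ∀ n r : ℕ,
      (∀ p₀ : ℕ, ∃ (p : ℕ) (_ : Fact p.Prime), p₀ ≤ p ∧
        tensorRank (matMulTensor (AlgebraicClosure (ZMod p)) n n n) ≤ r) →
      tensorRank (matMulTensor ℂ n n n) ≤ r) :
    ∀ ε : ℝ, 0 < ε → ∃ p₀ : ℕ, ∀ (p : ℕ) [Fact p.Prime], p₀ ≤ p →
      omega ℂ ≤ omega (AlgebraicClosure (ZMod p)) + ε := by
  intro ε hε
  obtain ⟨N, p₀, hW⟩ := hUW ε hε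
  -- Step 1 (dichotomy per pair): for every `(n, r)` there is a threshold `q` beyond which a rank
  -- bound `R_{F̄_p}(⟨n,n,n⟩) ≤ r` at a prime `p` transfers to `ℂ`.
  have key : ∀ n r : ℕ, ∃ q : ℕ, ∀ (p : ℕ) [Fact p.Prime], q ≤ p →
      tensorRank (matMulTensor (AlgebraicClosure (ZMod p)) n n n) ≤ r →
        tensorRank (matMulTensor ℂ n n n) ≤ r := by
    intro n r
    by_cases hgood : ∀ p₀ : ℕ, ∃ (p : ℕ) (_ : Fact p.Prime), p₀ ≤ p ∧
        tensorRank (matMulTensor (AlgebraicClosure (ZMod p)) n n n) ≤ r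
    · refine ⟨0, ?_⟩
      intro p _ _ _
      exact hTD n r hgood
    · obtain ⟨q, hq⟩ := not_forall.mp hgood
      refine ⟨q, ?_⟩
      intro p hp hqp hle
      exact (hq ⟨p, hp, hqp, hle⟩).elim
  choose q hq using key
  -- Step 2 (pigeonhole): one threshold past `p₀` and all `q n r`, `n ≤ N`, `r ≤ N³`.
  refine ⟨max p₀ ((Finset.range (N + 1)).sup fun m => (Finset.range (N * N * N + 1)).sup (q m)),
    ?_⟩
  intro p hp hp₁
  have hpp₀ : p₀ ≤ p := le_trans (le_max_left _ _) hp₁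
  obtain ⟨n, hn2, hnN, hR⟩ := hW p hpp₀
  -- the witness pair `(n, R_{F̄_p}(⟨n,n,n⟩))` lies in the finite box
  have hrN : tensorRank (matMulTensor (AlgebraicClosure (ZMod p)) n n n) ≤ N * N * N :=
    (tensorRank_matMulTensor_le _ n n n).trans (Nat.mul_le_mul (Nat.mul_le_mul hnN hnN) hnN)
  have h1 : q n (tensorRank (matMulTensor (AlgebraicClosure (ZMod p)) n n n)) ≤
      (Finset.range (N * N * N + 1)).sup (q n) :=
    Finset.le_sup (f := q n) (Finset.mem_range.mpr (Nat.lt_succ_of_le hrN))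
  have h2 : (Finset.range (N * N * N + 1)).sup (q n) ≤
      (Finset.range (N + 1)).sup (fun m => (Finset.range (N * N * N + 1)).sup (q m)) :=
    Finset.le_sup (f := fun m => (Finset.range (N * N * N + 1)).sup (q m))
      (Finset.mem_range.mpr (Nat.lt_succ_of_le hnN))
  have hqp : q n (tensorRank (matMulTensor (AlgebraicClosure (ZMod p)) n n n)) ≤ p :=
    le_trans (le_trans h1 h2) (le_trans (le_max_right _ _) hp₁)
  -- so its rank bound, which holds AT `p`, transfers to `ℂ`
  have hC : tensorRank (matMulTensor ℂ n n n) ≤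
      tensorRank (matMulTensor (AlgebraicClosure (ZMod p)) n n n) :=
    hq n _ p hqp le_rfl
  -- Step 3 (exponent): `ω(ℂ) ≤ log_n R_ℂ(⟨n,n,n⟩) ≤ log_n R_{F̄_p}(⟨n,n,n⟩) ≤ ω(F̄_p) + ε`.
  have hω : omega ℂ ≤
      Real.logb n (tensorRank (matMulTensor (AlgebraicClosure (ZMod p)) n n n)) :=
    advxxz2025_omega_le_logb_of_tensorRank_le ℂ hn2 hC
  have hn1 : (1 : ℝ) < (n : ℝ) := by exact_mod_cast (show 1 < n by omega)
  have hr0 : (0 : ℝ) < (tensorRank (matMulTensor (AlgebraicClosure (ZMod p)) n n n) : ℝ) :=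
    tensorRank_matMulTensor_pos _ hn2
  exact hω.trans ((Real.logb_le_iff_le_rpow hn1 hr0).mpr hR)

/-! ## The composition: the two stubs prove the crux BY NAME -/

/-- **THE SKELETON THEOREM.** The crux
`Summit.MatrixMultiplication.MatrixMultiplication.Theses.CharacteristicContinuity.ContinuityAtZero`
(stmt-MatrixMultiplication-18039), concluded BY NAME from the two DECLARED stubs `stub_uniformWitness`
(uniform witness sizes, the open regularity form) and `stub_transferDown` (one-system downward
Lefschetz, provable now) — the only `sorry`s of the file — through the sorry-free core
`continuityAtZero_of_uniformWitness_transferDown` and the `Iff.rfl` bridge `continuityAtZero_iff`.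
[folklore] -/
theorem ContinuityAtZero_of :
    Summit.MatrixMultiplication.MatrixMultiplication.Theses.CharacteristicContinuity.ContinuityAtZero :=
  continuityAtZero_iff.mpr
    (continuityAtZero_of_uniformWitness_transferDown stub_uniformWitness stub_transferDown)

end Summit.MatrixMultiplication.MatrixMultiplication.Cruxes.ContinuityAtZero.Birth

end
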